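import Summits.ValiantsHypothesis.ValiantsHypothesis.Theorems.SymPencilPerFourOneRowProductTools

/-!
# Route `SymPencil` — leaf R1N of the `(11, 5, 4)` cascade, §6.5 PRODUCT kernel plane: the four cases (`--supports`
# stmt-ValiantsHypothesis-5674 `SdcSuperquadratic`; memo `SING-FIVE-CLASSIFICATION.md` §6.5 (a), (b1), (b2), (b3))

Normalised position as in `…ProductTools`.
* `case_b2` — a coordinate `q ∈ {2,3}` of row `1` vanishing identically kills column `q` (no zero column);
* `case_a` — `αβ = 0`: rows `2, 3` perm-orthogonal to row `1` off one column `j`; a full-support element of row `1` puts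
  `W` in the cross (row `1`, column `j`) (`¬ InCross`), otherwise a column vanishes;
* `case_b3` — `U(u) ≡ 0`: `U(w) ≡ 0`, `(w₃, w₂) = λ(u₃, −u₂)` (`bilinear_identity`), and the explicit element with rows
  `1 = (α, −β, 1, 1)`, `t = (τ'α, −τ'β, −λ, λ)`, `τ' ∉ {0, λ, −λ}`, fails every STAR / BIPARTITE alternative of the
  per-direction test (`x₀₁ = −2αβτ'`, `x₀₂ = α(τ' − λ)`, `x₀₃ = α(τ' + λ)`) — the memo's `W(λ)` witness (P3);
* `case_b1` — the generic case: row `2` collapses to the line `K a` (`partner_vanish`), and at the element with row `2 = a`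
  the pair-`(1,2)` test reads `u₂ u₃ U(u) = 0`, false at a generic element of `W`.
The per-direction tests enter as hypotheses in the verbatim 7-disjunct text of ✓
`SymPencilPerFourTwoRowCorankTwo.star_or_bipartite_of_sum_sq_swap_rows01` (the workfile's tool (T1)).
Honest framing: [folklore] linear algebra for the PRODUCT branch of ONE leaf (R1N) of ONE of four open size-27 cells; leaf
R1N and the cell file remain OPEN; `27 ≤ sdc(per₄) ≤ 29` unchanged; the crux `SdcSuperquadratic` and `VP ≠ VNP` untouched;
no summit statement is proved here.  No definitions, no named facts.
-/

noncomputable section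

set_option linter.dupNamespace false

namespace Summit.ValiantsHypothesis.ValiantsHypothesis.Theorems.SymPencilPerFourOneRowProduct

open Matrix Module MvPolynomial
open Literature.Computability.AlgebraicComplexity
open Summit.ValiantsHypothesis.ValiantsHypothesis.Theorems.SymPencilSingSixClassification
open Summit.ValiantsHypothesis.ValiantsHypothesis.Theorems.SymPencilPerFourOneRowKernelPlane
open Summit.ValiantsHypothesis.ValiantsHypothesis.Theorems.SymPencilPerFourPermIsotropicPlanes

variable {K : Type*} [Field K]

/-! ## 3. Case (b2): a coordinate `q ∈ {2, 3}` of row `1` vanishes identically -/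

/-- **(b2)** If `u_q ≡ 0` on `W` (`q ∈ {2,3}`), `αβ ≠ 0`, then column `q` of `W` is zero — contradiction.
Inputs: the readings (E)/(F) in relation form, the rank of row `1`, the zero row `0`. [folklore] -/
theorem case_b2 {W : Submodule K (Fin 4 × Fin 4 → K)} {α β : K} (hα : α ≠ 0)
    (hi : ∀ y ∈ W, row y 0 = 0) (hcol : ∀ m : Fin 4, ∃ y ∈ W, ∃ x : Fin 4, y (x, m) ≠ 0)
    (hnr : finrank K (W.map (rowL 1)) = 3) (q : Fin 4) (hq : q = 2 ∨ q = 3)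
    (hE : ∀ y ∈ W, y (3, q) * (β * y (1, 0) + α * y (1, 1)) + y (1, q) * (β * y (3, 0) + α * y (3, 1)) = 0)
    (hF : ∀ y ∈ W, y (2, q) * (-β * y (1, 0) + α * y (1, 1)) + y (1, q) * (-β * y (2, 0) + α * y (2, 1)) = 0)
    (huq : ∀ y ∈ W, y (1, q) = 0) : False := by
  -- `U_a ∘ u` and `U_ā ∘ u` do not vanish identically (rank of row 1)
  have hq01 : q ≠ 0 ∧ q ≠ 1 := by rcases hq with rfl | rfl <;> decide
  have hUa : ∃ y₁ ∈ W, β * y₁ (1, 0) + α * y₁ (1, 1) ≠ 0 := by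
    by_contra h
    push Not at h
    refine not_two_conditions hnr (LinearMap.proj q) (β • LinearMap.proj 0 + α • LinearMap.proj 1)
      (z₁ := Pi.single q 1) (z₀ := Pi.single 1 1) (by simp) (by simp [hq01.2.symm])
      (by simp [hα]) (fun y hy => huq y hy) (fun y hy => ?_)
    simpa using h y hy
  have hUā : ∃ y₁ ∈ W, -β * y₁ (1, 0) + α * y₁ (1, 1) ≠ 0 := by
    by_contra h
    push Not at h
    refine not_two_conditions hnr (LinearMap.proj q) ((-β) • LinearMap.proj 0 + α • LinearMap.proj 1)
      (z₁ := Pi.single q 1) (z₀ := Pi.single 1 1) (by simp) (by simp [hq01.2.symm])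
      (by simp [hα]) (fun y hy => huq y hy) (fun y hy => ?_)
    simpa using h y hy
  obtain ⟨y₁, hy₁, hy₁U⟩ := hUa
  obtain ⟨y₂, hy₂, hy₂U⟩ := hUā
  -- `w_q ≡ 0` and `v_q ≡ 0`
  have hw : ∀ y ∈ W, y (3, q) = 0 :=
    vanish_of_mul_vanish W (fun y => β * y (1, 0) + α * y (1, 1)) (fun y => y (3, q))
      (fun a b => by simp only [Pi.add_apply]; ring) (fun a b => rfl)
      (fun y hy => by have := hE y hy; rw [huq y hy] at this; linear_combination this) hy₁ hy₁U
  have hv : ∀ y ∈ W, y (2, q) = 0 :=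
    vanish_of_mul_vanish W (fun y => -β * y (1, 0) + α * y (1, 1)) (fun y => y (2, q))
      (fun a b => by simp only [Pi.add_apply]; ring) (fun a b => rfl)
      (fun y hy => by have := hF y hy; rw [huq y hy] at this; linear_combination this) hy₂ hy₂U
  obtain ⟨y, hy, x, hx⟩ := hcol q
  fin_cases x
  · exact hx (congr_fun (hi y hy) q)
  · exact hx (huq y hy)
  · exact hx (hv y hy)
  · exact hx (hw y hy)



/-! ## 4. Case (a): `αβ = 0` — the rows `1, 2, 3` are pairwise perm-orthogonal off one column -/


/-- **Case (a)** (memo §6.5 (a)).  Zero row `0`; off the column `j`, row `1` of every element of `W` is perm-orthogonal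
to row `3` and to row `2` (`u°`, `v°`, `w°` = the rows with coordinate `j` zeroed).  If row `1` has an element of full
support off `j`, then (generic element + ✓ `permOrthPairs`) rows `2, 3` vanish off column `j` and `W` lies in the cross
(row `1`, column `j`); otherwise some coordinate `p ≠ j` of row `1` vanishes identically, and then column `p` of `W`
vanishes.  Either way a contradiction (`¬ InCross`, no zero column). [folklore] -/
theorem case_a [CharZero K] {W : Submodule K (Fin 4 × Fin 4 → K)} (j : Fin 4)
    (hi : ∀ y ∈ W, row y 0 = 0) (hcol : ∀ m : Fin 4, ∃ y ∈ W, ∃ x : Fin 4, y (x, m) ≠ 0)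
    (hX : ¬ InCross W) (hnr : finrank K (W.map (rowL 1)) = 3)
    (hw : ∀ y ∈ W, PermOrth (fun m => if m = j then 0 else y (1, m)) (fun m => if m = j then 0 else y (3, m)))
    (hv : ∀ y ∈ W, PermOrth (fun m => if m = j then 0 else y (1, m)) (fun m => if m = j then 0 else y (2, m))) :
    False := by
  classical
  -- generic vanishing of a row `x ∈ {2,3}` off column `j`, given a full-support element of row `1`
  have kill : ∀ x : Fin 4, (∀ y ∈ W, PermOrth (fun m => if m = j then 0 else y (1, m))
        (fun m => if m = j then 0 else y (x, m))) →
      (∀ m, m ≠ j → ∃ y ∈ W, y (1, m) ≠ 0) → ∀ k, k ≠ j → ∀ y ∈ W, y (x, k) = 0 := by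
    intro x hx hfull k hk y hy
    by_contra hyk
    -- a generic element: row 1 of full support off `j` and `(x,k)`-entry non-zero
    let T : Finset (Fin 4 × Fin 4) := (Finset.univ.filter fun m : Fin 4 => m ≠ j).image (fun m => ((1 : Fin 4), m)) ∪ {(x, k)}
    obtain ⟨z, hz, hzT⟩ := exists_forall_ne_zero W T (fun c => LinearMap.proj c) (by
      intro c hc
      rcases Finset.mem_union.1 hc with hc | hc
      · obtain ⟨m, hm, rfl⟩ := Finset.mem_image.1 hc
        have hmj : m ≠ j := (Finset.mem_filter.1 hm).2
        obtain ⟨y', hy', hne⟩ := hfull m hmj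
        exact ⟨y', hy', by simpa using hne⟩
      · rw [Finset.mem_singleton] at hc; subst hc
        exact ⟨y, hy, by simpa using hyk⟩)
    have hz1 : ∀ m, m ≠ j → z (1, m) ≠ 0 := fun m hm => by
      have := hzT (1, m) (Finset.mem_union_left _ (Finset.mem_image.2 ⟨m, by simp [hm], rfl⟩))
      simpa using this
    have hzk : z (x, k) ≠ 0 := by
      have := hzT (x, k) (Finset.mem_union_right _ (Finset.mem_singleton_self _))
      simpa using this
    rcases permOrthPairs _ _ (hx z hz) with h0 | h0 | ⟨j', c', hj'c', hsupp⟩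
    · obtain ⟨m, hmj, -⟩ := exists_other_index j j
      have := congr_fun h0 m
      simp only [hmj, if_false, Pi.zero_apply] at this
      exact hz1 m hmj this
    · have := congr_fun h0 k
      simp only [hk, if_false, Pi.zero_apply] at this
      exact hzk this
    · obtain ⟨i, hij', hic', hij⟩ := exists_third_index j j' c' hj'c'
      have := (hsupp i hij' hic').1
      simp only [hij, if_false] at this
      exact hz1 i hij this
  by_cases hfull : ∀ m, m ≠ j → ∃ y ∈ W, y (1, m) ≠ 0
  · -- rows 2 and 3 vanish off column `j`: `W` lies in the cross (row 1, column j)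
    have h3 := kill 3 hw hfull
    have h2 := kill 2 hv hfull
    refine hX ⟨1, j, fun y hy x m hx hm => ?_⟩
    fin_cases x
    · exact congr_fun (hi y hy) m
    · exact absurd rfl hx
    · exact h2 m hm y hy
    · exact h3 m hm y hy
  · -- some coordinate `p ≠ j` of row 1 vanishes identically; then column `p` vanishes
    push Not at hfull
    obtain ⟨p, hpj, hp⟩ := hfull
    obtain ⟨κ, hκj, hκp⟩ := exists_other_index j p
    -- `u_κ ≢ 0` (rank of row 1)
    have hκ : ∃ y₁ ∈ W, y₁ (1, κ) ≠ 0 := by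
      by_contra h
      push Not at h
      exact not_two_conditions hnr (LinearMap.proj p) (LinearMap.proj κ) (z₁ := Pi.single p 1)
        (z₀ := Pi.single κ 1) (by simp) (by simp [hκp]) (by simp) (fun y hy => hp y hy) (fun y hy => h y hy)
    obtain ⟨y₁, hy₁, hy₁κ⟩ := hκ
    have colp : ∀ x : Fin 4, (∀ y ∈ W, PermOrth (fun m => if m = j then 0 else y (1, m))
        (fun m => if m = j then 0 else y (x, m))) → ∀ y ∈ W, y (x, p) = 0 := by
      intro x hx
      refine vanish_of_mul_vanish W (fun y => y (1, κ)) (fun y => y (x, p)) (fun _ _ => rfl) (fun _ _ => rfl)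
        (fun y hy => ?_) hy₁ hy₁κ
      have h := hx y hy p κ (Ne.symm hκp)
      simp only [pairPerm, hpj, hκj, if_false, hp y hy, zero_mul, zero_add] at h
      linear_combination h
    obtain ⟨y, hy, x, hx⟩ := hcol p
    fin_cases x
    · exact hx (congr_fun (hi y hy) p)
    · exact hx (hp y hy)
    · exact hx (colp 2 hv y hy)
    · exact hx (colp 3 hw y hy)



/-! ## 6. Case (b3): row `1` of `W` lies in `{U_a = 0}` — the family `W(λ)` and its rank-`3` witness -/

/-- **Case (b3)** (memo §6.5 (b3)).  `αβ ≠ 0`; `U(u) = β u₀ + α u₁ ≡ 0` on row `1`; `u₂, u₃ ≢ 0`; the (E)-relations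
between row `1` and row `t` (`t ∈ {2,3}`); a pure generator `k₂ ∈ W` with row `1` zero and row `t = (α, −β, 0, 0)`; and
the per-direction STAR-or-BIPARTITE test for the pair `(1, t)`.  Then: `U(w) ≡ 0`, `(w₃, w₂) = (λ u₃, −λ u₂)` for a
constant `λ` (`bilinear_identity`), and at the element with row `1 = (α, −β, 1, 1)` and row `t = (τ'α, −τ'β, −λ, λ)`,
`τ' ∉ {0, λ, −λ}`, every STAR / BIPARTITE alternative has a non-zero entry (`x₀₁ = −2αβτ'`, `x₀₂ = α(τ'−λ)`,
`x₀₃ = α(τ'+λ)`) — contradiction. [folklore] -/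
theorem case_b3 [CharZero K] {W : Submodule K (Fin 4 × Fin 4 → K)} {α β : K} (hα : α ≠ 0) (hβ : β ≠ 0)
    (t : Fin 4) (hnr : finrank K (W.map (rowL 1)) = 3)
    (hE : ∀ y ∈ W, y (t, 2) * (β * y (1, 0) + α * y (1, 1)) + y (1, 2) * (β * y (t, 0) + α * y (t, 1)) = 0 ∧
      y (t, 3) * (β * y (1, 0) + α * y (1, 1)) + y (1, 3) * (β * y (t, 0) + α * y (t, 1)) = 0 ∧
      y (1, 2) * y (t, 3) + y (1, 3) * y (t, 2) = 0)
    (hk₂ : ∃ k ∈ W, row k 1 = 0 ∧ row k t = ![α, -β, 0, 0])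
    (hU : ∀ y ∈ W, β * y (1, 0) + α * y (1, 1) = 0) (hu2 : ∃ y ∈ W, y (1, 2) ≠ 0)
    (hT : ∀ y ∈ W,
      (((row y 1) 0 * (row y t) 1 + (row y 1) 1 * (row y t) 0 = 0 ∧ (row y 1) 0 * (row y t) 2 + (row y 1) 2 * (row y t) 0 = 0 ∧ (row y 1) 0 * (row y t) 3 + (row y 1) 3 * (row y t) 0 = 0) ∨
        ((row y 1) 0 * (row y t) 1 + (row y 1) 1 * (row y t) 0 = 0 ∧ (row y 1) 1 * (row y t) 2 + (row y 1) 2 * (row y t) 1 = 0 ∧ (row y 1) 1 * (row y t) 3 + (row y 1) 3 * (row y t) 1 = 0) ∨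
        ((row y 1) 0 * (row y t) 2 + (row y 1) 2 * (row y t) 0 = 0 ∧ (row y 1) 1 * (row y t) 2 + (row y 1) 2 * (row y t) 1 = 0 ∧ (row y 1) 2 * (row y t) 3 + (row y 1) 3 * (row y t) 2 = 0) ∨
        ((row y 1) 0 * (row y t) 3 + (row y 1) 3 * (row y t) 0 = 0 ∧ (row y 1) 1 * (row y t) 3 + (row y 1) 3 * (row y t) 1 = 0 ∧ (row y 1) 2 * (row y t) 3 + (row y 1) 3 * (row y t) 2 = 0)) ∨
      (((row y 1) 0 * (row y t) 1 + (row y 1) 1 * (row y t) 0 = 0 ∧ (row y 1) 2 * (row y t) 3 + (row y 1) 3 * (row y t) 2 = 0 ∧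
          ((row y 1) 0 * (row y t) 2 + (row y 1) 2 * (row y t) 0) * ((row y 1) 1 * (row y t) 3 + (row y 1) 3 * (row y t) 1) =
            ((row y 1) 0 * (row y t) 3 + (row y 1) 3 * (row y t) 0) * ((row y 1) 1 * (row y t) 2 + (row y 1) 2 * (row y t) 1)) ∨
        ((row y 1) 0 * (row y t) 2 + (row y 1) 2 * (row y t) 0 = 0 ∧ (row y 1) 1 * (row y t) 3 + (row y 1) 3 * (row y t) 1 = 0 ∧
          ((row y 1) 0 * (row y t) 1 + (row y 1) 1 * (row y t) 0) * ((row y 1) 2 * (row y t) 3 + (row y 1) 3 * (row y t) 2) =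
            ((row y 1) 0 * (row y t) 3 + (row y 1) 3 * (row y t) 0) * ((row y 1) 1 * (row y t) 2 + (row y 1) 2 * (row y t) 1)) ∨
        ((row y 1) 0 * (row y t) 3 + (row y 1) 3 * (row y t) 0 = 0 ∧ (row y 1) 1 * (row y t) 2 + (row y 1) 2 * (row y t) 1 = 0 ∧
          ((row y 1) 0 * (row y t) 1 + (row y 1) 1 * (row y t) 0) * ((row y 1) 2 * (row y t) 3 + (row y 1) 3 * (row y t) 2) =
            ((row y 1) 0 * (row y t) 2 + (row y 1) 2 * (row y t) 0) * ((row y 1) 1 * (row y t) 3 + (row y 1) 3 * (row y t) 1)))) : False := by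
  classical
  -- `U(w) ≡ 0`
  obtain ⟨y₂, hy₂, hy₂u⟩ := hu2
  have hUw : ∀ y ∈ W, β * y (t, 0) + α * y (t, 1) = 0 :=
    vanish_of_mul_vanish W (fun y => y (1, 2)) (fun y => β * y (t, 0) + α * y (t, 1)) (fun _ _ => rfl)
      (fun a b => by simp only [Pi.add_apply]; ring)
      (fun y hy => by have h := (hE y hy).1; rw [hU y hy, mul_zero, zero_add] at h; exact h) hy₂ hy₂u
  -- the functional `U` on row 1 and its kernel
  let Uf : (Fin 4 → K) →ₗ[K] K := β • LinearMap.proj 0 + α • LinearMap.proj 1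
  have hUf : ∀ z : Fin 4 → K, Uf z = β * z 0 + α * z 1 := fun z => by simp [Uf]
  have hUf1 : Uf (Pi.single 1 1) ≠ 0 := by rw [hUf]; simpa using hα
  have fill : ∀ z : Fin 4 → K, β * z 0 + α * z 1 = 0 → ∃ y ∈ W, row y 1 = z := fun z hz =>
    row_one_fills hnr Uf hUf1 (fun y hy => by rw [hUf]; exact hU y hy) z (by rw [hUf]; exact hz)
  -- the constant `λ`
  obtain ⟨y', hy', hr'⟩ := fill ![α, -β, 1, 0] (by simp; ring)
  obtain ⟨y'', hy'', hr''⟩ := fill ![α, -β, 0, 1] (by simp; ring)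
  have c1 : y' (1, 2) = 1 := by have := congr_fun hr' 2; simpa [SymPencilSingSixClassification.row] using this
  have c2 : y' (1, 3) = 0 := by have := congr_fun hr' 3; simpa [SymPencilSingSixClassification.row] using this
  have c3 : y'' (1, 2) = 0 := by have := congr_fun hr'' 2; simpa [SymPencilSingSixClassification.row] using this
  have c4 : y'' (1, 3) = 1 := by have := congr_fun hr'' 3; simpa [SymPencilSingSixClassification.row] using this
  obtain ⟨lam, hlam⟩ := bilinear_identity W (LinearMap.proj ((1 : Fin 4), (2 : Fin 4))) (LinearMap.proj ((1 : Fin 4), (3 : Fin 4)))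
    (LinearMap.proj (t, (3 : Fin 4))) (LinearMap.proj (t, (2 : Fin 4))) (fun y hy => by simpa using (hE y hy).2.2)
    hy' hy'' (by simpa using c1) (by simpa using c2) (by simpa using c3) (by simpa using c4)
  simp only [LinearMap.coe_proj, Function.eval] at hlam
  -- the witness element
  obtain ⟨y₀, hy₀, hr₀⟩ := fill ![α, -β, 1, 1] (by simp; ring)
  obtain ⟨k, hk, hk1, hkt⟩ := hk₂
  obtain ⟨τ', hτ'⟩ := Infinite.exists_notMem_finset ({0, lam, -lam} : Finset K)
  simp only [Finset.mem_insert, Finset.mem_singleton, not_or] at hτ'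
  obtain ⟨hτ0, hτ1, hτ2⟩ := hτ'
  set τ := y₀ (t, 0) / α with hτ
  set y₁ := y₀ + (τ' - τ) • k with hy₁def
  have hy₁ : y₁ ∈ W := W.add_mem hy₀ (W.smul_mem _ hk)
  have h10 : y₀ (t, 0) = τ * α := by rw [hτ, div_mul_cancel₀ _ hα]
  have h11 : y₀ (t, 1) = -(τ * β) := by
    have := hUw y₀ hy₀; rw [h10] at this
    have : α * (y₀ (t, 1) + τ * β) = 0 := by linear_combination this
    have := (mul_eq_zero.1 this).resolve_left hα
    linear_combination this
  have u2 : y₀ (1, 2) = 1 := by have := congr_fun hr₀ 2; simpa [SymPencilSingSixClassification.row] using this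
  have u3 : y₀ (1, 3) = 1 := by have := congr_fun hr₀ 3; simpa [SymPencilSingSixClassification.row] using this
  have h12 : y₀ (t, 2) = -lam := by have := (hlam y₀ hy₀).2; rw [u2] at this; simpa using this
  have h13 : y₀ (t, 3) = lam := by have := (hlam y₀ hy₀).1; rw [u3] at this; simpa using this
  have hr1 : row y₁ 1 = ![α, -β, 1, 1] := by
    rw [hy₁def, row_add, row_smul, hk1, smul_zero, add_zero, hr₀]
  have hrt : row y₁ t = ![τ' * α, -(τ' * β), -lam, lam] := by
    rw [hy₁def, row_add, row_smul, hkt]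
    funext m
    fin_cases m <;> simp [SymPencilSingSixClassification.row, h10, h11, h12, h13] <;> ring
  have hSB := hT y₁ hy₁
  rw [hr1, hrt] at hSB
  simp only [Matrix.cons_val_zero, Matrix.cons_val_one, Matrix.cons_val] at hSB
  have x01 : α * -(τ' * β) + -β * (τ' * α) ≠ 0 := by
    have : α * -(τ' * β) + -β * (τ' * α) = -2 * (α * (β * τ')) := by ring
    rw [this]; exact mul_ne_zero (by norm_num) (mul_ne_zero hα (mul_ne_zero hβ hτ0))
  have x02 : α * -lam + 1 * (τ' * α) ≠ 0 := by
    have : α * -lam + 1 * (τ' * α) = α * (τ' - lam) := by ring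
    rw [this]; exact mul_ne_zero hα (sub_ne_zero.2 hτ1)
  have x03 : α * lam + 1 * (τ' * α) ≠ 0 := by
    have : α * lam + 1 * (τ' * α) = α * (τ' - -lam) := by ring
    rw [this]; exact mul_ne_zero hα (sub_ne_zero.2 hτ2)
  rcases hSB with (h | h | h | h) | (h | h | h)
  · exact x01 h.1
  · exact x01 h.1
  · exact x02 h.1
  · exact x03 h.1
  · exact x01 h.1
  · exact x02 h.1
  · exact x03 h.1


/-! ## 7. Case (b1): generic row `1` — both companion rows collapse to lines and the pair `(1,2)` test fails -/

/-- **Case (b1)** (memo §6.5 (b1)).  `αβ ≠ 0`; none of `u₂, u₃, U(u), Ū(u)` vanishes identically on row `1`; the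
(F)-relations force `Ū(v) = v₂ = v₃ = 0` (`partner_vanish`), so row `2` of every element is a multiple of
`a = (α, β, 0, 0)`; shifting by the pure generator `k₁` makes it exactly `a`, where the STAR-or-BIPARTITE test for the
pair `(1, 2)` reads `u₂ u₃ U(u) = 0` — false at a generic element. [folklore] -/
theorem case_b1 [CharZero K] {W : Submodule K (Fin 4 × Fin 4 → K)} {α β : K} (hα : α ≠ 0)
    (hF : ∀ y ∈ W, y (2, 2) * (-β * y (1, 0) + α * y (1, 1)) + y (1, 2) * (-β * y (2, 0) + α * y (2, 1)) = 0 ∧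
      y (2, 3) * (-β * y (1, 0) + α * y (1, 1)) + y (1, 3) * (-β * y (2, 0) + α * y (2, 1)) = 0 ∧
      y (1, 2) * y (2, 3) + y (1, 3) * y (2, 2) = 0)
    (hk₁ : ∃ k ∈ W, row k 1 = 0 ∧ row k 2 = ![α, β, 0, 0])
    (hu2 : ∃ y ∈ W, y (1, 2) ≠ 0) (hu3 : ∃ y ∈ W, y (1, 3) ≠ 0)
    (hUu : ∃ y ∈ W, β * y (1, 0) + α * y (1, 1) ≠ 0) (hŪu : ∃ y ∈ W, -β * y (1, 0) + α * y (1, 1) ≠ 0)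
    (hT : ∀ y ∈ W,
      (((row y 1) 0 * (row y 2) 1 + (row y 1) 1 * (row y 2) 0 = 0 ∧ (row y 1) 0 * (row y 2) 2 + (row y 1) 2 * (row y 2) 0 = 0 ∧ (row y 1) 0 * (row y 2) 3 + (row y 1) 3 * (row y 2) 0 = 0) ∨
        ((row y 1) 0 * (row y 2) 1 + (row y 1) 1 * (row y 2) 0 = 0 ∧ (row y 1) 1 * (row y 2) 2 + (row y 1) 2 * (row y 2) 1 = 0 ∧ (row y 1) 1 * (row y 2) 3 + (row y 1) 3 * (row y 2) 1 = 0) ∨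
        ((row y 1) 0 * (row y 2) 2 + (row y 1) 2 * (row y 2) 0 = 0 ∧ (row y 1) 1 * (row y 2) 2 + (row y 1) 2 * (row y 2) 1 = 0 ∧ (row y 1) 2 * (row y 2) 3 + (row y 1) 3 * (row y 2) 2 = 0) ∨
        ((row y 1) 0 * (row y 2) 3 + (row y 1) 3 * (row y 2) 0 = 0 ∧ (row y 1) 1 * (row y 2) 3 + (row y 1) 3 * (row y 2) 1 = 0 ∧ (row y 1) 2 * (row y 2) 3 + (row y 1) 3 * (row y 2) 2 = 0)) ∨
      (((row y 1) 0 * (row y 2) 1 + (row y 1) 1 * (row y 2) 0 = 0 ∧ (row y 1) 2 * (row y 2) 3 + (row y 1) 3 * (row y 2) 2 = 0 ∧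
          ((row y 1) 0 * (row y 2) 2 + (row y 1) 2 * (row y 2) 0) * ((row y 1) 1 * (row y 2) 3 + (row y 1) 3 * (row y 2) 1) =
            ((row y 1) 0 * (row y 2) 3 + (row y 1) 3 * (row y 2) 0) * ((row y 1) 1 * (row y 2) 2 + (row y 1) 2 * (row y 2) 1)) ∨
        ((row y 1) 0 * (row y 2) 2 + (row y 1) 2 * (row y 2) 0 = 0 ∧ (row y 1) 1 * (row y 2) 3 + (row y 1) 3 * (row y 2) 1 = 0 ∧
          ((row y 1) 0 * (row y 2) 1 + (row y 1) 1 * (row y 2) 0) * ((row y 1) 2 * (row y 2) 3 + (row y 1) 3 * (row y 2) 2) =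
            ((row y 1) 0 * (row y 2) 3 + (row y 1) 3 * (row y 2) 0) * ((row y 1) 1 * (row y 2) 2 + (row y 1) 2 * (row y 2) 1)) ∨
        ((row y 1) 0 * (row y 2) 3 + (row y 1) 3 * (row y 2) 0 = 0 ∧ (row y 1) 1 * (row y 2) 2 + (row y 1) 2 * (row y 2) 1 = 0 ∧
          ((row y 1) 0 * (row y 2) 1 + (row y 1) 1 * (row y 2) 0) * ((row y 1) 2 * (row y 2) 3 + (row y 1) 3 * (row y 2) 2) =
            ((row y 1) 0 * (row y 2) 2 + (row y 1) 2 * (row y 2) 0) * ((row y 1) 1 * (row y 2) 3 + (row y 1) 3 * (row y 2) 1)))) : False := by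
  classical
  -- row 2 collapses: `Ū(v) = v₂ = v₃ = 0`
  have hv := partner_vanish W ((-β) • LinearMap.proj ((1 : Fin 4), (0 : Fin 4)) + α • LinearMap.proj ((1 : Fin 4), (1 : Fin 4)))
    (LinearMap.proj ((1 : Fin 4), (2 : Fin 4))) (LinearMap.proj ((1 : Fin 4), (3 : Fin 4)))
    ((-β) • LinearMap.proj ((2 : Fin 4), (0 : Fin 4)) + α • LinearMap.proj ((2 : Fin 4), (1 : Fin 4)))
    (LinearMap.proj ((2 : Fin 4), (2 : Fin 4))) (LinearMap.proj ((2 : Fin 4), (3 : Fin 4)))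
    (by simpa using hŪu) (by simpa using hu2) (by simpa using hu3)
    (fun y hy => by
      obtain ⟨e1, e2, e3⟩ := hF y hy
      refine permOrth_pad ?_ ?_ ?_
      · simp; linear_combination e1
      · simp; linear_combination e2
      · simp; linear_combination e3)
  simp only [LinearMap.add_apply, LinearMap.smul_apply, LinearMap.coe_proj, Function.eval, smul_eq_mul] at hv
  obtain ⟨k, hk, hk1, hk2⟩ := hk₁
  -- the product `u₂ u₃ U(u)` vanishes at every element
  have prod : ∀ y ∈ W, y (1, 2) * y (1, 3) * (β * y (1, 0) + α * y (1, 1)) = 0 := by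
    intro y hy
    obtain ⟨hv0, hv2, hv3⟩ := hv y hy
    set σ := y (2, 0) / α with hσ
    set y₁ := y + (1 - σ) • k with hy₁def
    have hy₁ : y₁ ∈ W := W.add_mem hy (W.smul_mem _ hk)
    have h20 : y (2, 0) = σ * α := by rw [hσ, div_mul_cancel₀ _ hα]
    have h21 : y (2, 1) = σ * β := by
      have : α * (y (2, 1) - σ * β) = 0 := by rw [h20] at hv0; linear_combination hv0
      have := (mul_eq_zero.1 this).resolve_left hα
      linear_combination this
    have hr1 : row y₁ 1 = row y 1 := by rw [hy₁def, row_add, row_smul, hk1, smul_zero, add_zero]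
    have hr2 : row y₁ 2 = ![α, β, 0, 0] := by
      rw [hy₁def, row_add, row_smul, hk2]
      funext m
      fin_cases m <;> simp [SymPencilSingSixClassification.row, h20, h21, hv2, hv3] <;> ring
    have hSB := hT y₁ hy₁
    rw [hr1, hr2] at hSB
    simp only [SymPencilSingSixClassification.row, Matrix.cons_val_zero, Matrix.cons_val_one, Matrix.cons_val, mul_zero, add_zero,
      zero_add] at hSB
    rcases hSB with (h | h | h | h) | (h | h | h)
    · linear_combination y (1, 2) * y (1, 3) * h.1
    · linear_combination y (1, 2) * y (1, 3) * h.1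
    · have : y (1, 2) = 0 := by have := h.1; exact (mul_eq_zero.1 (by linear_combination this : α * y (1, 2) = 0)).resolve_left hα
      rw [this]; ring
    · have : y (1, 3) = 0 := by have := h.1; exact (mul_eq_zero.1 (by linear_combination this : α * y (1, 3) = 0)).resolve_left hα
      rw [this]; ring
    · linear_combination y (1, 2) * y (1, 3) * h.1
    · have : y (1, 2) = 0 := by have := h.1; exact (mul_eq_zero.1 (by linear_combination this : α * y (1, 2) = 0)).resolve_left hα
      rw [this]; ring
    · have : y (1, 3) = 0 := by have := h.1; exact (mul_eq_zero.1 (by linear_combination this : α * y (1, 3) = 0)).resolve_left hα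
      rw [this]; ring
  -- a generic element contradicts it
  obtain ⟨z, hz, hzT⟩ := exists_forall_ne_zero W ({0, 1, 2} : Finset (Fin 3))
    ![LinearMap.proj ((1 : Fin 4), (2 : Fin 4)), LinearMap.proj ((1 : Fin 4), (3 : Fin 4)),
      β • LinearMap.proj ((1 : Fin 4), (0 : Fin 4)) + α • LinearMap.proj ((1 : Fin 4), (1 : Fin 4))] (by
    intro i hi
    fin_cases i
    · simpa using hu2
    · simpa using hu3
    · simpa using hUu)
  have z2 : z (1, 2) ≠ 0 := by simpa using hzT 0 (by simp)
  have z3 : z (1, 3) ≠ 0 := by simpa using hzT 1 (by simp)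
  have zU : β * z (1, 0) + α * z (1, 1) ≠ 0 := by simpa using hzT 2 (by simp)
  exact mul_ne_zero (mul_ne_zero z2 z3) zU (prod z hz)


end Summit.ValiantsHypothesis.ValiantsHypothesis.Theorems.SymPencilPerFourOneRowProduct

end
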